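import Literature.Geometry.Lorentzian.AdiabaticTracking
import Summits.FinalStateConjecture.FinalStateConjecture.Statement
import HarnessLib

/-!
# ASSEMBLE fragments for crux `DriftCapture` (stmt-FinalStateConjecture-17391), line `birth`:
# the degenerate range, the live-range reduction and the `N = 0` (dispersal) reduction of `stub_globalGauge`

The registered stub `stub_globalGauge` (ASSEMBLE) of the skeleton
`Summits/FinalStateConjecture/FinalStateConjecture/Cruxes/DriftCapture/Lines/birth.lean` says: for every
complexity `(N, m₀, χ)`, `0 < m₀`, `0 ≤ χ < 1`, every maximal vacuum Cauchy development `𝒟` of an admissible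
datum with complete `𝓘⁺`, and every point `(M, a, Λ)` of the moduli box `Mⱼ ∈ [m₀, m₀⁻¹]`, `|aⱼ| ≤ χ Mⱼ`:
if `𝒟` is adiabatically tracked at EVERY accuracy `(ε, L, R₀)` by chains of `ε`-approximate `N`-Kerr
configurations (`ApproximateKerrConfiguration`, the clause list of
`VacuumCauchyDevelopment.isAdiabaticallyTracked_iff`) all of whose window labels are `δ`-close to `(M, a, Λ)`,
for EVERY `δ > 0`, then `𝒟` carries a `C²` `FinalStateDecomposition d` with `d.N = N`, labels exactly
`(M, a)`, `O' = exteriorOf 𝒟 d.charted`, `HasExhaustiveCharts d` and `IsFutureOriented d` (the global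
late-time gauge patched from the window charts).

This file lands the parts of ASSEMBLE that hold by bookkeeping alone and isolates its live range:

* `globalGauge_of_one_lt` — for `N ≥ 1` and `1 < m₀` the moduli box is EMPTY (`m₀ ≤ M₀ ≤ m₀⁻¹ < m₀`), so
  the stub holds vacuously there (no tracking clause is used);
* `globalGauge_of_live` — the stub follows from its restriction to the LIVE RANGE `N = 0 ∨ m₀ ≤ 1`;
* `globalGauge_zero_of_dispersalGauge` — on `N = 0` the pinning clause and the label clause are empty, and
  the stub's `N = 0` instance is exactly DISPERSAL GAUGE: all-accuracy tracking with NO hole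
  (`𝒟.IsAdiabaticallyTracked 0 m₀ χ ε L R₀` for all `L > 0`, `ε > 0`, `R₀`: chains of `ε`-flat `C²` windows
  `[0, L] × ℝ³`, chained, exhausting, covering) ⇒ an honest, exhaustive, future-oriented `0`-hole
  decomposition (a converging flat late chart on the whole late half-space whose certified slabs cover
  `O' = J⁺(ι X) ∩ I⁻(charted)` causally at every chart time).
* `globalGauge_zero_of_flatLateChart` — the same with the `N = 0` target in CHART form: one anchored flat
  late chart `Φ : U₁ → 𝒟`, `U₁ ⊇ {x⁰ > τ₁}`, into `exteriorOf 𝒟 (Φ{x⁰ > τ₁})`, `deviationCk … 2 τ → 0`,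
  uncharted part below every slab `Φ{x⁰ = τ}`, `∂₀` eventually future-directed (the anchored-flat-chart
  vocabulary of crux `RecurrentlyFlatDisperses`) — packaged into the `0`-hole decomposition;
* `globalGauge_of_flatLateChart_of_pos` — hence ASSEMBLE = flat-window gluing (`N = 0`, chart form) +
  its own restriction to the multi-hole live range `0 < N`, `m₀ ≤ 1`.

What is NOT here (the live content of ASSEMBLE, no tree API): the chart-gluing — two window charts in which
`g` is `ε`-close in `C²` to the same (boosted) Kerr, resp. to `η`, on overlapping truncated slabs differ by a
`C³`-near-isometry of the background, so chained windows of accuracies `εₖ ↓ 0` patch into ONE late chart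
per background (`Spacetime.IsLateChart`) with `truncDeviationCk → 0`, horizon-normalised so that the
covering clause of `HasExhaustiveCharts` holds at every chart time; see the reply to the lead.

No definitions are introduced and no named facts are used.

References: Dafermos–Holzegel–Rodnianski–Taylor arXiv:2104.08222, §1 (the `Cᵏ`-deviation vocabulary);
Klainerman, C. R. Mécanique 353 (2025), §1.1.1, §2.3; Christodoulou–Klainerman 1993, Thm. 1.0.2 (dispersal).
-/

-- the doubled `FinalStateConjecture.FinalStateConjecture` path component trips dupNamespace
set_option linter.dupNamespace false

noncomputable section

namespace Summit.FinalStateConjecture.FinalStateConjecture.Theorems.RenormalisedDrift.DriftCapture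

open Set Filter Topology
open scoped Manifold ContDiff ENNReal
open Literature.Geometry.Lorentzian

/-- **ASSEMBLE, degenerate range.** With at least one hole (`0 < N`) and mass floor `1 < m₀` the moduli
box `Mⱼ ∈ [m₀, m₀⁻¹]` is empty (`m₀⁻¹ < 1 < m₀`), so the registered stub `stub_globalGauge` holds
vacuously on `N ≥ 1 ∧ 1 < m₀`: its box hypothesis at `j = 0` is contradictory. Nothing about the
development or the tracking chains is used. [folklore] -/
theorem globalGauge_of_one_lt : ∀ (N : ℕ) (m₀ χ : ℝ), 0 < N → 1 < m₀ → 0 < m₀ → 0 ≤ χ → χ < 1 → ∀ (X : Type) [TopologicalSpace X] [ChartedSpace E3 X] [IsManifold (𝓡 3) ((⊤ : ℕ∞) : WithTop ℕ∞) X] [T2Space X] [SecondCountableTopology X] [ConnectedSpace X], ∀ D ∈ admissibleVacuumData X, ∀ 𝒟 : VacuumCauchyDevelopment D, 𝒟.IsMaximal → Summit.FinalStateConjecture.HasCompleteNullInfinity 𝒟.toCauchyDevelopment → ∀ (M a : Fin N → ℝ) (Λ : Fin N → lorentzGroup), (∀ j, m₀ ≤ M j ∧ M j ≤ m₀⁻¹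 ∧ |a j| ≤ χ * M j) → (∀ δ : ℝ, 0 < δ → ∀ (L : ℝ) (ε : ENNReal) (R₀ : ℝ), 0 < L → 0 < ε → ∃ (R : ℕ → ℝ) (O : Set 𝒟.carrier) (c : ∀ n : ℕ, ApproximateKerrConfiguration 𝒟.toSpacetime O 2 ε 0 L (R n)), (∀ n, R₀ ≤ R n) ∧ Tendsto R atTop atTop ∧ (∀ n, (c n).N = N) ∧ (∀ n (i : Fin (c n).N), m₀ ≤ (c n).mass i ∧ (c n).mass i ≤ m₀⁻¹ ∧ |(c n).spin i| ≤ χ * (c n).mass i) ∧ (∀ n (i : Fin (c n).N) (j : Fin N), (i : ℕ) = (j : ℕ) → |(c n).mass i - M j| ≤ δ ∧ |(c n).spin i - a j| ≤ δ ∧ ‖((((c n).motion i).1 : E4 ≃L[ℝ] E4) : E4 →L[ℝ] E4) - (((Λ j : E4 ≃L[ℝ] E4)) : E4 →L[ℝ] E4)‖ ≤ δ) ∧ (∀ n, (c (n + 1)).certifiedSlab 0 ⊆ (c n).windowImage) ∧ (∀ K : Set 𝒟.carrier, IsCompact K → ∃ n₀ : ℕ, ∀ n, n₀ ≤ n → Disjoint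 (c n).windowImage (𝒟.metric.causalPast 𝒟.timeOrientation K)) ∧ O = 𝒟.toCauchyDevelopment.exteriorOf (⋃ n, (c n).windowImage) ∧ O ⊆ 𝒟.metric.causalPast 𝒟.timeOrientation ((c 0).certifiedSlab 0) ∪ ⋃ n, (c n).windowImage) → ∃ (O' : Set 𝒟.carrier) (d : FinalStateDecomposition 𝒟.toSpacetime O' 2), d.N = N ∧ (∀ (i : Fin d.N) (j : Fin N), (i : ℕ) = (j : ℕ) → d.mass i = M j ∧ d.spin i = a j) ∧ O' = Summit.FinalStateConjecture.exteriorOf 𝒟.toCauchyDevelopment d.charted ∧ Summit.FinalStateConjecture.HasExhaustiveCharts d ∧ Summit.FinalStateConjecture.IsFutureOriented d := by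
  intro N m₀ χ hN hm₀ _ _ _ X _ _ _ _ _ _ D _ 𝒟 _ _ M a Λ hbox _
  exfalso
  obtain ⟨h₁, h₂, -⟩ := hbox ⟨0, hN⟩
  have h : m₀⁻¹ < m₀ :=
    calc m₀⁻¹ < 1 := inv_lt_one_of_one_lt₀ hm₀
      _ < m₀ := hm₀
  exact absurd (h₁.trans h₂) (not_le.2 h)

/-- **ASSEMBLE reduces to its live range `N = 0 ∨ m₀ ≤ 1`.** The registered stub `stub_globalGauge`
(verbatim, the conclusion) follows from its restriction to the complexities with no hole or with mass
floor `m₀ ≤ 1` (the hypothesis): the complementary range `N ≥ 1 ∧ 1 < m₀` is `globalGauge_of_one_lt`.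
[folklore] -/
theorem globalGauge_of_live :
    (∀ (N : ℕ) (m₀ χ : ℝ), (N = 0 ∨ m₀ ≤ 1) → 0 < m₀ → 0 ≤ χ → χ < 1 → ∀ (X : Type) [TopologicalSpace X] [ChartedSpace E3 X] [IsManifold (𝓡 3) ((⊤ : ℕ∞) : WithTop ℕ∞) X] [T2Space X] [SecondCountableTopology X] [ConnectedSpace X], ∀ D ∈ admissibleVacuumData X, ∀ 𝒟 : VacuumCauchyDevelopment D, 𝒟.IsMaximal → Summit.FinalStateConjecture.HasCompleteNullInfinity 𝒟.toCauchyDevelopment → ∀ (M a : Fin N → ℝ) (Λ : Fin N → lorentzGroup), (∀ j, m₀ ≤ M j ∧ M j ≤ m₀⁻¹ ∧ |a j| ≤ χ * M j) → (∀ δ : ℝ, 0 < δ → ∀ (L : ℝ) (ε : ENNReal) (R₀ : ℝ), 0 < L → 0 < ε → ∃ (R : ℕ → ℝ) (O : Set 𝒟.carrier) (c : ∀ n : ℕ, ApproximateKerrConfiguration 𝒟.toSpacetime O 2 ε 0 L (R n)), (∀ n, R₀ ≤ R n) ∧ Tendsto R atTop atTop ∧ (∀ n, (c n).N = N) ∧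 (∀ n (i : Fin (c n).N), m₀ ≤ (c n).mass i ∧ (c n).mass i ≤ m₀⁻¹ ∧ |(c n).spin i| ≤ χ * (c n).mass i) ∧ (∀ n (i : Fin (c n).N) (j : Fin N), (i : ℕ) = (j : ℕ) → |(c n).mass i - M j| ≤ δ ∧ |(c n).spin i - a j| ≤ δ ∧ ‖((((c n).motion i).1 : E4 ≃L[ℝ] E4) : E4 →L[ℝ] E4) - (((Λ j : E4 ≃L[ℝ] E4)) : E4 →L[ℝ] E4)‖ ≤ δ) ∧ (∀ n, (c (n + 1)).certifiedSlab 0 ⊆ (c n).windowImage) ∧ (∀ K : Set 𝒟.carrier, IsCompact K → ∃ n₀ : ℕ, ∀ n, n₀ ≤ n → Disjoint (c n).windowImage (𝒟.metric.causalPast 𝒟.timeOrientation K)) ∧ O = 𝒟.toCauchyDevelopment.exteriorOf (⋃ n, (c n).windowImage) ∧ O ⊆ 𝒟.metric.causalPast 𝒟.timeOrientation ((c 0).certifiedSlab 0) ∪ ⋃ n, (c n).windowImage) → ∃ (O' : Set 𝒟.carrier) (d : FinalStateDecomposition 𝒟.toSpacetime O' 2), d.N = N ∧ (∀ (i : Fin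 d.N) (j : Fin N), (i : ℕ) = (j : ℕ) → d.mass i = M j ∧ d.spin i = a j) ∧ O' = Summit.FinalStateConjecture.exteriorOf 𝒟.toCauchyDevelopment d.charted ∧ Summit.FinalStateConjecture.HasExhaustiveCharts d ∧ Summit.FinalStateConjecture.IsFutureOriented d) →
    ∀ (N : ℕ) (m₀ χ : ℝ), 0 < m₀ → 0 ≤ χ → χ < 1 → ∀ (X : Type) [TopologicalSpace X] [ChartedSpace E3 X] [IsManifold (𝓡 3) ((⊤ : ℕ∞) : WithTop ℕ∞) X] [T2Space X] [SecondCountableTopology X] [ConnectedSpace X], ∀ D ∈ admissibleVacuumData X, ∀ 𝒟 : VacuumCauchyDevelopment D, 𝒟.IsMaximal → Summit.FinalStateConjecture.HasCompleteNullInfinity 𝒟.toCauchyDevelopment → ∀ (M a : Fin N → ℝ) (Λ : Fin N → lorentzGroup), (∀ j, m₀ ≤ M j ∧ M j ≤ m₀⁻¹ ∧ |a j| ≤ χ * M j) → (∀ δ : ℝ, 0 < δ → ∀ (L : ℝ) (ε : ENNReal) (R₀ : ℝ), 0 < L → 0 < ε → ∃ (R : ℕ → ℝ) (O : Set 𝒟.carrier)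 (c : ∀ n : ℕ, ApproximateKerrConfiguration 𝒟.toSpacetime O 2 ε 0 L (R n)), (∀ n, R₀ ≤ R n) ∧ Tendsto R atTop atTop ∧ (∀ n, (c n).N = N) ∧ (∀ n (i : Fin (c n).N), m₀ ≤ (c n).mass i ∧ (c n).mass i ≤ m₀⁻¹ ∧ |(c n).spin i| ≤ χ * (c n).mass i) ∧ (∀ n (i : Fin (c n).N) (j : Fin N), (i : ℕ) = (j : ℕ) → |(c n).mass i - M j| ≤ δ ∧ |(c n).spin i - a j| ≤ δ ∧ ‖((((c n).motion i).1 : E4 ≃L[ℝ] E4) : E4 →L[ℝ] E4) - (((Λ j : E4 ≃L[ℝ] E4)) : E4 →L[ℝ] E4)‖ ≤ δ) ∧ (∀ n, (c (n + 1)).certifiedSlab 0 ⊆ (c n).windowImage) ∧ (∀ K : Set 𝒟.carrier, IsCompact K → ∃ n₀ : ℕ, ∀ n, n₀ ≤ n → Disjoint (c n).windowImage (𝒟.metric.causalPast 𝒟.timeOrientation K)) ∧ O = 𝒟.toCauchyDevelopment.exteriorOf (⋃ n, (c n).windowImage) ∧ O ⊆ 𝒟.metric.causalPast 𝒟.timeOrientation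 ((c 0).certifiedSlab 0) ∪ ⋃ n, (c n).windowImage) → ∃ (O' : Set 𝒟.carrier) (d : FinalStateDecomposition 𝒟.toSpacetime O' 2), d.N = N ∧ (∀ (i : Fin d.N) (j : Fin N), (i : ℕ) = (j : ℕ) → d.mass i = M j ∧ d.spin i = a j) ∧ O' = Summit.FinalStateConjecture.exteriorOf 𝒟.toCauchyDevelopment d.charted ∧ Summit.FinalStateConjecture.HasExhaustiveCharts d ∧ Summit.FinalStateConjecture.IsFutureOriented d := by
  intro H N m₀ χ hm₀ hχ₀ hχ₁
  by_cases h : N = 0 ∨ m₀ ≤ 1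
  · exact H N m₀ χ h hm₀ hχ₀ hχ₁
  · push Not at h
    exact globalGauge_of_one_lt N m₀ χ (Nat.pos_of_ne_zero h.1) h.2 hm₀ hχ₀ hχ₁

/-- **ASSEMBLE at `N = 0` is dispersal gauge.** If all-accuracy tracking with NO hole
(`𝒟.IsAdiabaticallyTracked 0 m₀ χ ε L R₀` for all `L > 0`, `ε > 0`, `R₀`) yields an honest, exhaustive,
future-oriented `0`-hole `C²` decomposition `d` of `O' = exteriorOf 𝒟 d.charted` (the hypothesis:
"dispersal gauge", the `N = 0` global-gauge gluing of `ε`-flat windows, Christodoulou–Klainerman's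
conclusion shape), then the `N = 0` instance of the registered stub `stub_globalGauge` holds (the
conclusion, verbatim with `N := 0`): at the empty label the pinned chains are tracked chains (drop the
empty pinning clause) and the label clause of the conclusion is empty. [folklore] -/
theorem globalGauge_zero_of_dispersalGauge :
    (∀ (m₀ χ : ℝ), 0 < m₀ → 0 ≤ χ → χ < 1 → ∀ (X : Type) [TopologicalSpace X] [ChartedSpace E3 X] [IsManifold (𝓡 3) ((⊤ : ℕ∞) : WithTop ℕ∞) X] [T2Space X] [SecondCountableTopology X] [ConnectedSpace X], ∀ D ∈ admissibleVacuumData X, ∀ 𝒟 : VacuumCauchyDevelopment D, 𝒟.IsMaximal → Summit.FinalStateConjecture.HasCompleteNullInfinity 𝒟.toCauchyDevelopment → (∀ (L : ℝ) (ε : ENNReal) (R₀ : ℝ), 0 < L → 0 < ε → 𝒟.IsAdiabaticallyTracked 0 m₀ χ ε L R₀) → ∃ (O' : Set 𝒟.carrier) (d : FinalStateDecomposition 𝒟.toSpacetime O' 2), d.N = 0 ∧ O' = Summit.FinalStateConjecture.exteriorOf 𝒟.toCauchyDevelopment d.charted ∧ Summit.FinalStateConjecture.HasExhaustiveCharts d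 ∧ Summit.FinalStateConjecture.IsFutureOriented d) →
    ∀ (m₀ χ : ℝ), 0 < m₀ → 0 ≤ χ → χ < 1 → ∀ (X : Type) [TopologicalSpace X] [ChartedSpace E3 X] [IsManifold (𝓡 3) ((⊤ : ℕ∞) : WithTop ℕ∞) X] [T2Space X] [SecondCountableTopology X] [ConnectedSpace X], ∀ D ∈ admissibleVacuumData X, ∀ 𝒟 : VacuumCauchyDevelopment D, 𝒟.IsMaximal → Summit.FinalStateConjecture.HasCompleteNullInfinity 𝒟.toCauchyDevelopment → ∀ (M a : Fin 0 → ℝ) (Λ : Fin 0 → lorentzGroup), (∀ j, m₀ ≤ M j ∧ M j ≤ m₀⁻¹ ∧ |a j| ≤ χ * M j) → (∀ δ : ℝ, 0 < δ → ∀ (L : ℝ) (ε : ENNReal) (R₀ : ℝ), 0 < L → 0 < ε → ∃ (R : ℕ → ℝ) (O : Set 𝒟.carrier) (c : ∀ n : ℕ, ApproximateKerrConfiguration 𝒟.toSpacetime O 2 ε 0 L (R n)), (∀ n, R₀ ≤ R n) ∧ Tendsto R atTop atTop ∧ (∀ n, (c n).N = 0) ∧ (∀ n (i : Fin (c n).N),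 m₀ ≤ (c n).mass i ∧ (c n).mass i ≤ m₀⁻¹ ∧ |(c n).spin i| ≤ χ * (c n).mass i) ∧ (∀ n (i : Fin (c n).N) (j : Fin 0), (i : ℕ) = (j : ℕ) → |(c n).mass i - M j| ≤ δ ∧ |(c n).spin i - a j| ≤ δ ∧ ‖((((c n).motion i).1 : E4 ≃L[ℝ] E4) : E4 →L[ℝ] E4) - (((Λ j : E4 ≃L[ℝ] E4)) : E4 →L[ℝ] E4)‖ ≤ δ) ∧ (∀ n, (c (n + 1)).certifiedSlab 0 ⊆ (c n).windowImage) ∧ (∀ K : Set 𝒟.carrier, IsCompact K → ∃ n₀ : ℕ, ∀ n, n₀ ≤ n → Disjoint (c n).windowImage (𝒟.metric.causalPast 𝒟.timeOrientation K)) ∧ O = 𝒟.toCauchyDevelopment.exteriorOf (⋃ n, (c n).windowImage) ∧ O ⊆ 𝒟.metric.causalPast 𝒟.timeOrientation ((c 0).certifiedSlab 0) ∪ ⋃ n, (c n).windowImage) → ∃ (O' : Set 𝒟.carrier) (d : FinalStateDecomposition 𝒟.toSpacetime O' 2), d.N = 0 ∧ (∀ (i : Fin d.N) (j : Fin 0),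 (i : ℕ) = (j : ℕ) → d.mass i = M j ∧ d.spin i = a j) ∧ O' = Summit.FinalStateConjecture.exteriorOf 𝒟.toCauchyDevelopment d.charted ∧ Summit.FinalStateConjecture.HasExhaustiveCharts d ∧ Summit.FinalStateConjecture.IsFutureOriented d := by
  intro H m₀ χ hm₀ hχ₀ hχ₁ X _ _ _ _ _ _ D hD 𝒟 hmax hscri M a Λ _ hpin
  have htrack : ∀ (L : ℝ) (ε : ENNReal) (R₀ : ℝ), 0 < L → 0 < ε →
      𝒟.IsAdiabaticallyTracked 0 m₀ χ ε L R₀ := fun L ε R₀ hL hε ↦ by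
    obtain ⟨R, O, c, hR, hRt, hN, hM, -, hch, hex, hO, hcov⟩ := hpin 1 one_pos L ε R₀ hL hε
    exact ⟨R, O, c, hR, hRt, hN, hM, hch, hex, hO, hcov⟩
  obtain ⟨O', d, hN, hO', hexh, hfut⟩ := H m₀ χ hm₀ hχ₀ hχ₁ X D hD 𝒟 hmax hscri htrack
  exact ⟨O', d, hN, fun _ j _ ↦ j.elim0, hO', hexh, hfut⟩

/-- **ASSEMBLE at `N = 0` from ONE anchored flat late chart (flat-window gluing).** Suppose that
all-accuracy tracking with NO hole (`𝒟.IsAdiabaticallyTracked 0 m₀ χ ε L R₀` for all `L > 0`, `ε > 0`,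
`R₀`: chains of `ε`-flat `C²` windows `[0, L] × ℝ³`, chained, exhausting, covering) yields ONE anchored
flat late chart — a flat domain `U₁ ⊇ {x⁰ > τ₁}`, a late chart `Φ : U₁ → 𝒟` into its self-determined
exterior `O₁ = J⁺(ι X) ∩ I⁻(Φ{x⁰ > τ₁})` with `C²` deviation from `η` tending to `0`, whose uncharted part
beyond every chart time `τ ≥ τ₁` lies causally below the slab `Φ{x⁰ = τ}`, and whose `∂₀` is eventually
future-directed (the hypothesis: the `N = 0` global gauge, i.e. the gluing of the chains' `ε`-flat window
charts through near-Poincaré transition maps; the anchored-flat-chart vocabulary of crux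
`RecurrentlyFlatDisperses`, `Theorems.RecurrentlyFlatDisperses.stub_settlesOfScriCapture`). Then the
`N = 0` instance of the registered stub `stub_globalGauge` holds (verbatim with `N := 0`): the `0`-hole
`C²` decomposition with flat chart `Φ` on `U₁` (every clause over `Fin 0` empty) has
`O₁ = exteriorOf 𝒟 d.charted`, `HasExhaustiveCharts d` (certified regions = the flat pieces) and
`IsFutureOriented d` (its flat clause). Christodoulou–Klainerman 1993, Thm. 1.0.2 (shape of the
conclusion). [folklore] -/
theorem globalGauge_zero_of_flatLateChart : (∀ (m₀ χ : ℝ), 0 < m₀ → 0 ≤ χ → χ < 1 → ∀ (X : Type) [TopologicalSpace X] [ChartedSpace E3 X] [IsManifold (𝓡 3) ((⊤ : ℕ∞) : WithTop ℕ∞) X] [T2Space X] [SecondCountableTopology X] [ConnectedSpace X], ∀ D ∈ admissibleVacuumData X, ∀ 𝒟 : VacuumCauchyDevelopment D, 𝒟.IsMaximal → Summit.FinalStateConjecture.HasCompleteNullInfinity 𝒟.toCauchyDevelopment → (∀ (L : ℝ) (ε : ENNReal) (R₀ : ℝ), 0 < L → 0 < ε → 𝒟.IsAdiabaticallyTracked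 0 m₀ χ ε L R₀) → ∃ (τ₁ : ℝ) (U₁ : TopologicalSpace.Opens E4) (Φ : U₁ → 𝒟.carrier), {x : E4 | τ₁ < x 0} ⊆ (U₁ : Set E4) ∧ 𝒟.toSpacetime.IsLateChart (Minkowski.backgroundOn U₁) (Summit.FinalStateConjecture.exteriorOf 𝒟.toCauchyDevelopment (Φ '' (Minkowski.backgroundOn U₁).lateRegion τ₁)) τ₁ Φ ∧ Tendsto (fun τ ↦ 𝒟.toSpacetime.deviationCk (Minkowski.backgroundOn U₁) Φ 2 τ) atTop (𝓝 0) ∧ (∀ τ : ℝ, τ₁ ≤ τ → Summit.FinalStateConjecture.exteriorOf 𝒟.toCauchyDevelopment (Φ '' (Minkowski.backgroundOn U₁).lateRegion τ₁) \ Φ '' (Minkowski.backgroundOn U₁).lateRegion τ ⊆ 𝒟.metric.causalPast 𝒟.timeOrientation (Φ '' (Minkowski.backgroundOn U₁).timeSlab τ)) ∧ ∀ᶠ τ in atTop, ∀ x ∈ (Minkowski.backgroundOn U₁).timeSlab τ, 𝒟.toSpacetime.timeOrientation.IsFutureDirected (mfderiv 𝓘(ℝ, E4) (𝓡 4) Φ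 x (E4.basisVector 0))) → ∀ (m₀ χ : ℝ), 0 < m₀ → 0 ≤ χ → χ < 1 → ∀ (X : Type) [TopologicalSpace X] [ChartedSpace E3 X] [IsManifold (𝓡 3) ((⊤ : ℕ∞) : WithTop ℕ∞) X] [T2Space X] [SecondCountableTopology X] [ConnectedSpace X], ∀ D ∈ admissibleVacuumData X, ∀ 𝒟 : VacuumCauchyDevelopment D, 𝒟.IsMaximal → Summit.FinalStateConjecture.HasCompleteNullInfinity 𝒟.toCauchyDevelopment → ∀ (M a : Fin 0 → ℝ) (Λ : Fin 0 → lorentzGroup), (∀ j, m₀ ≤ M j ∧ M j ≤ m₀⁻¹ ∧ |a j| ≤ χ * M j) → (∀ δ : ℝ, 0 < δ → ∀ (L : ℝ) (ε : ENNReal) (R₀ : ℝ), 0 < L → 0 < ε → ∃ (R : ℕ → ℝ) (O : Set 𝒟.carrier) (c : ∀ n : ℕ, ApproximateKerrConfiguration 𝒟.toSpacetime O 2 ε 0 L (R n)), (∀ n, R₀ ≤ R n) ∧ Tendsto R atTop atTop ∧ (∀ n, (c n).N = 0) ∧ (∀ n (i : Fin (c n).N), m₀ ≤ (c n).mass i ∧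 (c n).mass i ≤ m₀⁻¹ ∧ |(c n).spin i| ≤ χ * (c n).mass i) ∧ (∀ n (i : Fin (c n).N) (j : Fin 0), (i : ℕ) = (j : ℕ) → |(c n).mass i - M j| ≤ δ ∧ |(c n).spin i - a j| ≤ δ ∧ ‖((((c n).motion i).1 : E4 ≃L[ℝ] E4) : E4 →L[ℝ] E4) - (((Λ j : E4 ≃L[ℝ] E4)) : E4 →L[ℝ] E4)‖ ≤ δ) ∧ (∀ n, (c (n + 1)).certifiedSlab 0 ⊆ (c n).windowImage) ∧ (∀ K : Set 𝒟.carrier, IsCompact K → ∃ n₀ : ℕ, ∀ n, n₀ ≤ n → Disjoint (c n).windowImage (𝒟.metric.causalPast 𝒟.timeOrientation K)) ∧ O = 𝒟.toCauchyDevelopment.exteriorOf (⋃ n, (c n).windowImage) ∧ O ⊆ 𝒟.metric.causalPast 𝒟.timeOrientation ((c 0).certifiedSlab 0) ∪ ⋃ n, (c n).windowImage) → ∃ (O' : Set 𝒟.carrier) (d : FinalStateDecomposition 𝒟.toSpacetime O' 2), d.N = 0 ∧ (∀ (i : Fin d.N) (j : Fin 0), (i : ℕ) = (j : ℕ) → d.mass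 i = M j ∧ d.spin i = a j) ∧ O' = Summit.FinalStateConjecture.exteriorOf 𝒟.toCauchyDevelopment d.charted ∧ Summit.FinalStateConjecture.HasExhaustiveCharts d ∧ Summit.FinalStateConjecture.IsFutureOriented d := by
  intro H m₀ χ hm₀ hχ₀ hχ₁ X _ _ _ _ _ _ D hD 𝒟 hmax hscri M a Λ _ hpin
  have htrack : ∀ (L : ℝ) (ε : ENNReal) (R₀ : ℝ), 0 < L → 0 < ε →
      𝒟.IsAdiabaticallyTracked 0 m₀ χ ε L R₀ := fun L ε R₀ hL hε ↦ by
    obtain ⟨R, O, c, hR, hRt, hN, hM, -, hch, hex, hO, hcov⟩ := hpin 1 one_pos L ε R₀ hL hε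
    exact ⟨R, O, c, hR, hRt, hN, hM, hch, hex, hO, hcov⟩
  obtain ⟨τ₁, U₁, Φ, hU, hlate, hdev, hexh, hfut⟩ := H m₀ χ hm₀ hχ₀ hχ₁ X D hD 𝒟 hmax hscri htrack
  -- the `0`-hole decomposition of the self-determined exterior of the flat chart
  let O' : Set 𝒟.carrier := Summit.FinalStateConjecture.exteriorOf 𝒟.toCauchyDevelopment
    (Φ '' (Minkowski.backgroundOn U₁).lateRegion τ₁)
  let d : FinalStateDecomposition 𝒟.toSpacetime O' 2 :=
    { N := 0
      mass := Fin.elim0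
      spin := Fin.elim0
      mass_pos := fun i ↦ i.elim0
      abs_spin_le_mass := fun i ↦ i.elim0
      motion := Fin.elim0
      τ₀ := τ₁
      chart := fun i ↦ i.elim0
      isLateChart := fun i ↦ i.elim0
      tendsto_truncDeviationCk := fun i ↦ i.elim0
      exists_pairwise_disjoint := fun _ ↦ ⟨0, fun i ↦ i.elim0⟩
      excision := Fin.elim0
      tendsto_excision_div := fun i ↦ i.elim0
      flatDomain := U₁
      setOf_lt_excision_subset_flatDomain := fun x hx ↦ hU hx.1
      flatChart := Φ
      isLateChart_flat := hlate
      tendsto_deviationCk_flat := hdev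
      diff_subset_causalPast := by
        intro p hp
        have hp2 : p ∉ Φ '' (Minkowski.backgroundOn U₁).lateRegion τ₁ :=
          fun h' ↦ hp.2 (Or.inr h')
        exact LorentzianMetric.causalFuture_mono subset_union_right (hexh τ₁ le_rfl ⟨hp.1, hp2⟩) }
  -- `d.charted = Φ '' {x⁰ > τ₁} ∪ ⋃ (over Fin 0)`
  have hch : d.charted = Φ '' (Minkowski.backgroundOn U₁).lateRegion τ₁ := by
    ext p
    simp only [FinalStateDecomposition.charted, Set.mem_union, Set.mem_iUnion]
    constructor
    · rintro (h' | ⟨i, -⟩)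
      · exact h'
      · exact i.elim0
    · exact fun h' ↦ Or.inl h'
  refine ⟨O', d, rfl, fun _ j _ ↦ j.elim0, by rw [hch],
    ⟨fun i ↦ i.elim0, fun i ↦ i.elim0, fun i ↦ i.elim0, fun τ hτ ↦ ?_⟩,
    ⟨fun i ↦ i.elim0, fun i ↦ i.elim0, hfut⟩⟩
  -- exhaustion at chart time `τ > τ₁`: the certified pieces are the flat ones
  intro p hp
  have hp2 : p ∉ Φ '' (Minkowski.backgroundOn U₁).lateRegion τ := fun h' ↦ hp.2 (Or.inl h')
  exact LorentzianMetric.causalFuture_mono subset_union_left (hexh τ hτ.le ⟨hp.1, hp2⟩)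

/-- **ASSEMBLE = flat-window gluing (`N = 0`) + multi-Kerr window gluing (`N ≥ 1`, `m₀ ≤ 1`).** The
registered stub `stub_globalGauge` (verbatim, the conclusion) follows from (i) the `N = 0` global gauge
in anchored-flat-chart form (hypothesis of `globalGauge_zero_of_flatLateChart`) and (ii) its own
restriction to the live multi-hole range `0 < N`, `m₀ ≤ 1` (where the moduli box is inhabited and the
content is the patching of the pinned chains' hole and flat window charts into `N + 1` horizon-normalised
late charts); the remaining range `0 < N`, `1 < m₀` is `globalGauge_of_one_lt`. [folklore] -/
theorem globalGauge_of_flatLateChart_of_pos :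
    (∀ (m₀ χ : ℝ), 0 < m₀ → 0 ≤ χ → χ < 1 → ∀ (X : Type) [TopologicalSpace X] [ChartedSpace E3 X] [IsManifold (𝓡 3) ((⊤ : ℕ∞) : WithTop ℕ∞) X] [T2Space X] [SecondCountableTopology X] [ConnectedSpace X], ∀ D ∈ admissibleVacuumData X, ∀ 𝒟 : VacuumCauchyDevelopment D, 𝒟.IsMaximal → Summit.FinalStateConjecture.HasCompleteNullInfinity 𝒟.toCauchyDevelopment → (∀ (L : ℝ) (ε : ENNReal) (R₀ : ℝ), 0 < L → 0 < ε → 𝒟.IsAdiabaticallyTracked 0 m₀ χ ε L R₀) → ∃ (τ₁ : ℝ) (U₁ : TopologicalSpace.Opens E4) (Φ : U₁ → 𝒟.carrier), {x : E4 | τ₁ < x 0} ⊆ (U₁ : Set E4) ∧ 𝒟.toSpacetime.IsLateChart (Minkowski.backgroundOn U₁) (Summit.FinalStateConjecture.exteriorOf 𝒟.toCauchyDevelopment (Φ '' (Minkowski.backgroundOn U₁).lateRegion τ₁)) τ₁ Φ ∧ Tendsto (fun τ ↦ 𝒟.toSpacetime.deviationCk (Minkowski.backgroundOn U₁) Φ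 2 τ) atTop (𝓝 0) ∧ (∀ τ : ℝ, τ₁ ≤ τ → Summit.FinalStateConjecture.exteriorOf 𝒟.toCauchyDevelopment (Φ '' (Minkowski.backgroundOn U₁).lateRegion τ₁) \ Φ '' (Minkowski.backgroundOn U₁).lateRegion τ ⊆ 𝒟.metric.causalPast 𝒟.timeOrientation (Φ '' (Minkowski.backgroundOn U₁).timeSlab τ)) ∧ ∀ᶠ τ in atTop, ∀ x ∈ (Minkowski.backgroundOn U₁).timeSlab τ, 𝒟.toSpacetime.timeOrientation.IsFutureDirected (mfderiv 𝓘(ℝ, E4) (𝓡 4) Φ x (E4.basisVector 0))) →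
    (∀ (N : ℕ) (m₀ χ : ℝ), 0 < N → m₀ ≤ 1 → 0 < m₀ → 0 ≤ χ → χ < 1 → ∀ (X : Type) [TopologicalSpace X] [ChartedSpace E3 X] [IsManifold (𝓡 3) ((⊤ : ℕ∞) : WithTop ℕ∞) X] [T2Space X] [SecondCountableTopology X] [ConnectedSpace X], ∀ D ∈ admissibleVacuumData X, ∀ 𝒟 : VacuumCauchyDevelopment D, 𝒟.IsMaximal → Summit.FinalStateConjecture.HasCompleteNullInfinity 𝒟.toCauchyDevelopment → ∀ (M a : Fin N → ℝ) (Λ : Fin N → lorentzGroup), (∀ j, m₀ ≤ M j ∧ M j ≤ m₀⁻¹ ∧ |a j| ≤ χ * M j) → (∀ δ : ℝ, 0 < δ → ∀ (L : ℝ) (ε : ENNReal) (R₀ : ℝ), 0 < L → 0 < ε → ∃ (R : ℕ → ℝ) (O : Set 𝒟.carrier) (c : ∀ n : ℕ, ApproximateKerrConfiguration 𝒟.toSpacetime O 2 ε 0 L (R n)), (∀ n, R₀ ≤ R n) ∧ Tendsto R atTop atTop ∧ (∀ n, (c n).N = N) ∧ (∀ n (i : Fin (c n).N), m₀ ≤ (c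 n).mass i ∧ (c n).mass i ≤ m₀⁻¹ ∧ |(c n).spin i| ≤ χ * (c n).mass i) ∧ (∀ n (i : Fin (c n).N) (j : Fin N), (i : ℕ) = (j : ℕ) → |(c n).mass i - M j| ≤ δ ∧ |(c n).spin i - a j| ≤ δ ∧ ‖((((c n).motion i).1 : E4 ≃L[ℝ] E4) : E4 →L[ℝ] E4) - (((Λ j : E4 ≃L[ℝ] E4)) : E4 →L[ℝ] E4)‖ ≤ δ) ∧ (∀ n, (c (n + 1)).certifiedSlab 0 ⊆ (c n).windowImage) ∧ (∀ K : Set 𝒟.carrier, IsCompact K → ∃ n₀ : ℕ, ∀ n, n₀ ≤ n → Disjoint (c n).windowImage (𝒟.metric.causalPast 𝒟.timeOrientation K)) ∧ O = 𝒟.toCauchyDevelopment.exteriorOf (⋃ n, (c n).windowImage) ∧ O ⊆ 𝒟.metric.causalPast 𝒟.timeOrientation ((c 0).certifiedSlab 0) ∪ ⋃ n, (c n).windowImage) → ∃ (O' : Set 𝒟.carrier) (d : FinalStateDecomposition 𝒟.toSpacetime O' 2), d.N = N ∧ (∀ (i : Fin d.N) (j : Fin N), (i : ℕ) = (j : ℕ)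 → d.mass i = M j ∧ d.spin i = a j) ∧ O' = Summit.FinalStateConjecture.exteriorOf 𝒟.toCauchyDevelopment d.charted ∧ Summit.FinalStateConjecture.HasExhaustiveCharts d ∧ Summit.FinalStateConjecture.IsFutureOriented d) →
    ∀ (N : ℕ) (m₀ χ : ℝ), 0 < m₀ → 0 ≤ χ → χ < 1 → ∀ (X : Type) [TopologicalSpace X] [ChartedSpace E3 X] [IsManifold (𝓡 3) ((⊤ : ℕ∞) : WithTop ℕ∞) X] [T2Space X] [SecondCountableTopology X] [ConnectedSpace X], ∀ D ∈ admissibleVacuumData X, ∀ 𝒟 : VacuumCauchyDevelopment D, 𝒟.IsMaximal → Summit.FinalStateConjecture.HasCompleteNullInfinity 𝒟.toCauchyDevelopment → ∀ (M a : Fin N → ℝ) (Λ : Fin N → lorentzGroup), (∀ j, m₀ ≤ M j ∧ M j ≤ m₀⁻¹ ∧ |a j| ≤ χ * M j) → (∀ δ : ℝ, 0 < δ → ∀ (L : ℝ) (ε : ENNReal) (R₀ : ℝ), 0 < L → 0 < ε → ∃ (R : ℕ → ℝ) (O : Set 𝒟.carrier) (c : ∀ n : ℕ, ApproximateKerrConfiguration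 𝒟.toSpacetime O 2 ε 0 L (R n)), (∀ n, R₀ ≤ R n) ∧ Tendsto R atTop atTop ∧ (∀ n, (c n).N = N) ∧ (∀ n (i : Fin (c n).N), m₀ ≤ (c n).mass i ∧ (c n).mass i ≤ m₀⁻¹ ∧ |(c n).spin i| ≤ χ * (c n).mass i) ∧ (∀ n (i : Fin (c n).N) (j : Fin N), (i : ℕ) = (j : ℕ) → |(c n).mass i - M j| ≤ δ ∧ |(c n).spin i - a j| ≤ δ ∧ ‖((((c n).motion i).1 : E4 ≃L[ℝ] E4) : E4 →L[ℝ] E4) - (((Λ j : E4 ≃L[ℝ] E4)) : E4 →L[ℝ] E4)‖ ≤ δ) ∧ (∀ n, (c (n + 1)).certifiedSlab 0 ⊆ (c n).windowImage) ∧ (∀ K : Set 𝒟.carrier, IsCompact K → ∃ n₀ : ℕ, ∀ n, n₀ ≤ n → Disjoint (c n).windowImage (𝒟.metric.causalPast 𝒟.timeOrientation K)) ∧ O = 𝒟.toCauchyDevelopment.exteriorOf (⋃ n, (c n).windowImage) ∧ O ⊆ 𝒟.metric.causalPast 𝒟.timeOrientation ((c 0).certifiedSlab 0) ∪ ⋃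 n, (c n).windowImage) → ∃ (O' : Set 𝒟.carrier) (d : FinalStateDecomposition 𝒟.toSpacetime O' 2), d.N = N ∧ (∀ (i : Fin d.N) (j : Fin N), (i : ℕ) = (j : ℕ) → d.mass i = M j ∧ d.spin i = a j) ∧ O' = Summit.FinalStateConjecture.exteriorOf 𝒟.toCauchyDevelopment d.charted ∧ Summit.FinalStateConjecture.HasExhaustiveCharts d ∧ Summit.FinalStateConjecture.IsFutureOriented d := by
  intro H₀ H N m₀ χ hm₀ hχ₀ hχ₁
  rcases Nat.eq_zero_or_pos N with rfl | hN
  · exact globalGauge_zero_of_flatLateChart H₀ m₀ χ hm₀ hχ₀ hχ₁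
  · by_cases hm : m₀ ≤ 1
    · exact H N m₀ χ hN hm hm₀ hχ₀ hχ₁
    · exact globalGauge_of_one_lt N m₀ χ hN (not_le.1 hm) hm₀ hχ₀ hχ₁

end Summit.FinalStateConjecture.FinalStateConjecture.Theorems.RenormalisedDrift.DriftCapture

end
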